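import Summits.RiemannHypothesis.RiemannHypothesis.Theorems.WeilFormatCTailMajorant
import Summits.RiemannHypothesis.RiemannHypothesis.Theorems.WeilFormatCSoundness
import Summits.RiemannHypothesis.RiemannHypothesis.Theorems.WeilFormatCFarDiagPos
import Summits.RiemannHypothesis.RiemannHypothesis.Theorems.WeilFormatCSectorKernels
import Summits.RiemannHypothesis.RiemannHypothesis.Theorems.WeilFormatCEntrySesq
import Summits.RiemannHypothesis.RiemannHypothesis.Theorems.WeilFormatCCertificate
import Summits.RiemannHypothesis.RiemannHypothesis.Theorems.WeilFormatCDataRung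
import Summits.RiemannHypothesis.RiemannHypothesis.Theorems.WeilFormatCDataRungGeneric
import Summits.RiemannHypothesis.RiemannHypothesis.Theorems.WeilFormatCFarAssemblyA
import HarnessLib

/-!
# Format C: the GENERIC data front door with a CERTIFIED prime constant — `weilPositivityOn_of_formatC_kernelsA`

Route context: Fourier–Galerkin / Schur-complement certificates of Weil positivity on a window ("format C";
cell memos `run/shared/lean/pub/rh-explicit/rh-explicit-weil-10/FORMATC-DESIGN.md` §9.9 (doors, PRODUCTION-TABLE-v2) and
`…/rh-explicit-weil-1/FORMAT-K3.md` (certified prime constants); supporting stmt-RiemannHypothesis-0098; seat rh-explicit-weil-1 gen4).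

This is `WeilFormatC.weilPositivityOn_of_formatC_kernels` (weil-10, `WeilFormatCDataRungGeneric.lean`) VERBATIM except that
the PRIME part of the two far diagonals is `A/2` for a certified prime constant `A` supplied as the hypothesis

  `hPA : ∀ s (c : ℤ → ℂ), −(A·Σ_{n∈s}‖c n‖²) ≤ Σ_{n,m∈s} Re(conj c_n · c_m)·primeCoeff a n m`

(the statement shape of `WeilFormatC.primeCoeff_form_ge_cells_one_v2` — `A = 2027/1000` for `a ≤ 1` — and of the other
route-K2/K3 bound files, and of `primeCoeff_form_ge` itself with `A = A_op⁺(a)`), instead of the path-graph constant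
`A_op⁺(a)/2 = ½Σ_{k∈weilPrimeIndex a} Λ(k)k^{−1/2}·2cos(π/(⌊2a/log k⌋+2))` hardwired in `…_of_formatC_kernels`.  The production
sizing of the cell's table v2 (K-CELL-2) was computed with the certified constants (`A_used = 2.386` at `a = 1`); this door
lets the generated rung files use them in the kernel.  Far bounds: `gramCoeff_even_far_ge_diag_A` /
`gramCoeff_odd_far_ge_diag_atan_A` (`WeilFormatCFarAssemblyA.lean`); positivity propagation on the far range by
`even/odd_dhat_core_mono` + `hilbert_atan_penalty_le`; everything else (column majorant, tail premise `hU2`, kernel PSD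
checks `hSe`/`hSo`, the sector assembly) exactly as in the weil-10 door.

* `weilPositivityOn_of_formatC_kernelsA` — the generic door with the prime constant as a parameter.

Standard axioms; no definitions; no RH claim (a rung `WeilPositivityOn a` is one case of
`riemannHypothesis_iff_forall_weilPositivityOn`).
-/

set_option autoImplicit false
-- `Summit.RiemannHypothesis.RiemannHypothesis.…` is the layout-mandated namespace (summit = problem name).
set_option linter.dupNamespace false

noncomputable section

open Complex Finset Matrix
open scoped Real BigOperators ComplexConjugate ArithmeticFunction.vonMangoldt

namespace Summit.RiemannHypothesis.RiemannHypothesis.Theorems.WeilFormatC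

open Literature.NumberTheory.LFunctions Literature.NumberTheory.LFunctions.Yoshida1992
open Literature.Analysis.SpecialFunctions

variable {a : ℝ}

/-! ## The data-only rung theorem -/

section Rung

/-- **Format C, generic data front door with a CERTIFIED prime constant `A`.**  See the module docstring: per sector, exact columns on `[B, B₃)` with
weights `w`, an ARBITRARY tail matrix `U₂` certified by the majorant premise `hU2`, and the kernel PSD check against
`M − U₁ − U₂`; the conclusion is the rung `WeilPositivityOn a`.  (Even block: modes `0..B⁺−1`; odd block: kernel indices
`0..B⁻−1` = modes `1..B⁻`.)  The far diagonals carry `A/2` (hypothesis `hPA`) in place of `A_op⁺/2`. [folklore] -/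
theorem weilPositivityOn_of_formatC_kernelsA (ha : 0 < a)
    -- the certified PRIME constant of the window (`primeCoeff_form_ge_cells_*`, or `A_op⁺` via `primeCoeff_form_ge`)
    {A : ℝ} (hPA : ∀ (s : Finset ℤ) (c : ℤ → ℂ),
      -(A * ∑ n ∈ s, ‖c n‖ ^ 2) ≤ ∑ n ∈ s, ∑ m ∈ s, (conj (c n) * c m).re * primeCoeff a n m)
    -- EVEN sector data
    {Be B3e : ℕ} (hBe : 2 ≤ Be) (hBBe : Be ≤ B3e) {d0e : ℝ}
    (we : ℕ → ℝ)
    (h0e : 0 < ((reDigammaQuarter (freq a Be) - Real.log π) / 2 - a * (1 + weilArchDensity (2 * a)) / (π ^ 2 * Be ^ 2) - 1 / (8 * Be) - a * (1 + weilArchDensity (2 * a)) / π ^ 2 * Real.sqrt (8 / ((Be - 1 : ℕ) : ℝ)) - A / 2))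
    (hd0e : 0 < d0e ∧ d0e ≤ ((reDigammaQuarter (freq a B3e) - Real.log π) / 2 - a * (1 + weilArchDensity (2 * a)) / (π ^ 2 * B3e ^ 2) - 1 / (8 * B3e) - a * (1 + weilArchDensity (2 * a)) / π ^ 2 * Real.sqrt (8 / ((Be - 1 : ℕ) : ℝ)) - A / 2))
    (hwe : ∀ m, Be ≤ m → m < B3e → 0 < we m ∧ we m ≤ ((reDigammaQuarter (freq a m) - Real.log π) / 2 - a * (1 + weilArchDensity (2 * a)) / (π ^ 2 * m ^ 2) - 1 / (8 * m) - a * (1 + weilArchDensity (2 * a)) / π ^ 2 * Real.sqrt (8 / ((Be - 1 : ℕ) : ℝ)) - A / 2))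
    (U2e : Matrix (Fin Be) (Fin Be) ℝ)
    (hU2e : ∀ d : ℕ → ℝ, (∀ m, B3e ≤ m → d0e ≤ d m) → ∀ (N : ℕ) (x : Fin Be → ℝ),
      ∑ m ∈ Finset.Ico B3e N, (∑ i : Fin Be, (if (i : ℕ) = 0 then gramCoeff a 0 m else if m = 0 then gramCoeff a i 0 else (gramCoeff a i m + gramCoeff a i (-(m : ℤ))) / 2) * x i) ^ 2 / d m
        ≤ x ⬝ᵥ U2e *ᵥ x)
    (hSe : ∀ x : Fin Be → ℝ, 0 ≤ ∑ i, ∑ i', x i * x i' *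
      ((if (i : ℕ) = 0 then gramCoeff a 0 i' else if (i' : ℕ) = 0 then gramCoeff a i 0 else (gramCoeff a i i' + gramCoeff a i (-(i' : ℤ))) / 2)
        - (∑ m ∈ Finset.Ico Be B3e, (if (i : ℕ) = 0 then gramCoeff a 0 m else if m = 0 then gramCoeff a i 0 else (gramCoeff a i m + gramCoeff a i (-(m : ℤ))) / 2) * (if (i' : ℕ) = 0 then gramCoeff a 0 m else if m = 0 then gramCoeff a i' 0 else (gramCoeff a i' m + gramCoeff a i' (-(m : ℤ))) / 2) / we m)
        - U2e i i'))
    -- ODD sector data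
    {Bo B3o : ℕ} (hBo : 1 ≤ Bo) (hBBo : Bo ≤ B3o) {d0o : ℝ}
    (wo : ℕ → ℝ)
    (h0o : 0 < ((reDigammaQuarter (freq a ((Bo : ℤ) + 1)) - Real.log π) / 2 - 1 / (8 * ((Bo : ℝ) + 1)) - a * (1 + weilArchDensity (2 * a)) / (π ^ 2 * ((Bo : ℝ) + 1) ^ 2)) - π / 4 - a * (1 + weilArchDensity (2 * a)) / π ^ 2 * Real.sqrt (8 / Bo) - A / 2 - (Real.exp (a / 2) - Real.exp (-(a / 2))) ^ 2 * a / (π ^ 2 * Bo))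
    (hd0o : 0 < d0o ∧ d0o ≤ ((reDigammaQuarter (freq a ((B3o : ℤ) + 1)) - Real.log π) / 2 - 1 / (8 * ((B3o : ℝ) + 1)) - a * (1 + weilArchDensity (2 * a)) / (π ^ 2 * ((B3o : ℝ) + 1) ^ 2)) - π / 4 - a * (1 + weilArchDensity (2 * a)) / π ^ 2 * Real.sqrt (8 / Bo) - A / 2 - (Real.exp (a / 2) - Real.exp (-(a / 2))) ^ 2 * a / (π ^ 2 * Bo))
    (hwo : ∀ l, Bo ≤ l → l < B3o → 0 < wo l ∧ wo l ≤ ((reDigammaQuarter (freq a ((l : ℤ) + 1)) - Real.log π) / 2 - 1 / (8 * ((l : ℝ) + 1)) - a * (1 + weilArchDensity (2 * a)) / (π ^ 2 * ((l : ℝ) + 1) ^ 2) - (π / 2 - Real.arctan (Real.sqrt Bo / Real.sqrt ((l : ℝ) + 1))) / 2 - a * (1 + weilArchDensity (2 * a)) / π ^ 2 * Real.sqrt (8 / Bo) - A / 2 - (Real.exp (a / 2) - Real.exp (-(a / 2))) ^ 2 * a / (π ^ 2 * Bo)))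
    (U2o : Matrix (Fin Bo) (Fin Bo) ℝ)
    (hU2o : ∀ d : ℕ → ℝ, (∀ l, B3o ≤ l → d0o ≤ d l) → ∀ (N : ℕ) (x : Fin Bo → ℝ),
      ∑ l ∈ Finset.Ico B3o N, (∑ k : Fin Bo, ((gramCoeff a (((k : ℕ) : ℤ) + 1) ((l : ℤ) + 1) - gramCoeff a (((k : ℕ) : ℤ) + 1) (-((l : ℤ) + 1))) / 2) * x k) ^ 2 / d l
        ≤ x ⬝ᵥ U2o *ᵥ x)
    (hSo : ∀ x : Fin Bo → ℝ, 0 ≤ ∑ k, ∑ k', x k * x k' *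
      (((gramCoeff a (((k : ℕ) : ℤ) + 1) (((k' : ℕ) : ℤ) + 1) - gramCoeff a (((k : ℕ) : ℤ) + 1) (-(((k' : ℕ) : ℤ) + 1))) / 2)
        - (∑ l ∈ Finset.Ico Bo B3o, ((gramCoeff a (((k : ℕ) : ℤ) + 1) ((l : ℤ) + 1) - gramCoeff a (((k : ℕ) : ℤ) + 1) (-((l : ℤ) + 1))) / 2) * ((gramCoeff a (((k' : ℕ) : ℤ) + 1) ((l : ℤ) + 1) - gramCoeff a (((k' : ℕ) : ℤ) + 1) (-((l : ℤ) + 1))) / 2) / wo l)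
        - U2o k k')) :
    WeilPositivityOn a := by
  have hE0 : 0 < weilArchDensity (2 * a) := weilArchDensity_pos (by positivity)
  have hC : 0 ≤ a * (1 + weilArchDensity (2 * a)) := by positivity
  -- the sector kernels and far diagonals as functions
  set Mev : ℕ → ℕ → ℝ := fun i j ↦ (if i = 0 then gramCoeff a 0 j else if j = 0 then gramCoeff a i 0 else (gramCoeff a i j + gramCoeff a i (-(j : ℤ))) / 2) with hMev
  set Mod : ℕ → ℕ → ℝ := fun k l ↦ ((gramCoeff a ((k : ℤ) + 1) ((l : ℤ) + 1) - gramCoeff a ((k : ℤ) + 1) (-((l : ℤ) + 1))) / 2) with hMod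
  set dev : ℕ → ℝ := fun m ↦ ((reDigammaQuarter (freq a m) - Real.log π) / 2 - a * (1 + weilArchDensity (2 * a)) / (π ^ 2 * m ^ 2) - 1 / (8 * m) - a * (1 + weilArchDensity (2 * a)) / π ^ 2 * Real.sqrt (8 / ((Be - 1 : ℕ) : ℝ)) - A / 2) with hdev
  set dod : ℕ → ℝ := fun l ↦ ((reDigammaQuarter (freq a ((l : ℤ) + 1)) - Real.log π) / 2 - 1 / (8 * ((l : ℝ) + 1)) - a * (1 + weilArchDensity (2 * a)) / (π ^ 2 * ((l : ℝ) + 1) ^ 2) - (π / 2 - Real.arctan (Real.sqrt Bo / Real.sqrt ((l : ℝ) + 1))) / 2 - a * (1 + weilArchDensity (2 * a)) / π ^ 2 * Real.sqrt (8 / Bo) - A / 2 - (Real.exp (a / 2) - Real.exp (-(a / 2))) ^ 2 * a / (π ^ 2 * Bo)) with hdod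
  refine weilPositivityOn_of_sector_kernels_nonneg ha (gramCoeff a) (weilWindowSesq_chi ha) (gramCoeff_neg_neg a)
    ?_ ?_
  · -- EVEN sector
    intro K y
    have hB3e1 : 1 ≤ B3e := by omega
    have hd : ∀ m, Be ≤ m → 0 < dev m := fun m hm ↦ by
      simp only [hdev]
      have h := even_dhat_core_mono ha hC (le_trans (by norm_num) hBe) hm
      linarith [h0e]
    have hdmono : ∀ m, B3e ≤ m → d0e ≤ dev m := fun m hm ↦ by
      simp only [hdev]
      have h := even_dhat_core_mono ha hC hB3e1 hm
      linarith [hd0e.2]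
    have hfar : ∀ (N : ℕ) (y : ℕ → ℝ),
        ∑ n ∈ Finset.Ico Be N, dev n * y n ^ 2 ≤ ∑ n ∈ Finset.Ico Be N, ∑ m ∈ Finset.Ico Be N, y n * Mev n m * y m :=
      fun N y ↦ by
        simp only [hdev, hMev]
        exact gramCoeff_even_far_ge_diag_A ha hPA hBe N y
    have hU1 : ∀ x : Fin Be → ℝ,
        ∑ m ∈ Finset.Ico Be B3e, (∑ i : Fin Be, Mev i m * x i) ^ 2 / dev m
          ≤ x ⬝ᵥ (Matrix.of fun i j : Fin Be ↦ ∑ m ∈ Finset.Ico Be B3e, Mev i m * Mev j m / we m) *ᵥ x :=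
      fun x ↦ columns_majorant (Finset.Ico Be B3e) (fun m i ↦ Mev i m) dev we
        (fun m hm ↦ by
          have hm := Finset.mem_Ico.mp hm
          have h := hwe m hm.1 hm.2
          simp only [hdev]
          exact h) x
    have hU2 := fun (N : ℕ) (x : Fin Be → ℝ) ↦ hU2e dev hdmono N x
    have key := sum_range_mul_mul_nonneg_of_certificate_sum_split Mev
      (fun n m ↦ evenKernel_symm (gramCoeff a) (gramCoeff_comm a) (gramCoeff_neg_neg a) n m)
      Be B3e hBBe dev _ _ hd hfar hU1 (fun N x ↦ by
        have h := hU2 N x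
        simp only [hMev, hdev] at h ⊢
        exact h) (fun x ↦ by
        have h := hSe x
        simp only [hMev, Matrix.of_apply] at h ⊢
        exact h) K y
    simpa only [hMev] using key
  · -- ODD sector
    intro K z
    have hB3o : 1 ≤ B3o := by omega
    have hd : ∀ l, Bo ≤ l → 0 < dod l := fun l hl ↦ by
      simp only [hdod]
      have h := odd_dhat_core_mono ha hC hl
      have hpen := hilbert_atan_penalty_le Bo l
      linarith [h0o]
    have hdlow : ∀ l, B3o ≤ l → d0o ≤ dod l := fun l hl ↦ by
      simp only [hdod]
      have h := odd_dhat_core_mono ha hC hl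
      have hpen := hilbert_atan_penalty_le Bo l
      linarith [hd0o.2]
    have hfar : ∀ (N : ℕ) (z : ℕ → ℝ),
        ∑ k ∈ Finset.Ico Bo N, dod k * z k ^ 2 ≤ ∑ k ∈ Finset.Ico Bo N, ∑ l ∈ Finset.Ico Bo N, z k * Mod k l * z l :=
      fun N z ↦ by
        simp only [hdod, hMod]
        exact gramCoeff_odd_far_ge_diag_atan_A ha hPA hBo N z
    have hU1 : ∀ x : Fin Bo → ℝ,
        ∑ l ∈ Finset.Ico Bo B3o, (∑ k : Fin Bo, Mod k l * x k) ^ 2 / dod l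
          ≤ x ⬝ᵥ (Matrix.of fun k k' : Fin Bo ↦ ∑ l ∈ Finset.Ico Bo B3o, Mod k l * Mod k' l / wo l) *ᵥ x :=
      fun x ↦ columns_majorant (Finset.Ico Bo B3o) (fun l k ↦ Mod k l) dod wo
        (fun l hl ↦ by
          have hl := Finset.mem_Ico.mp hl
          have h := hwo l hl.1 hl.2
          simp only [hdod]
          exact h) x
    have hU2 := fun (N : ℕ) (x : Fin Bo → ℝ) ↦ hU2o dod hdlow N x
    have key := sum_range_mul_mul_nonneg_of_certificate_sum_split Mod
      (fun k l ↦ oddKernel_symm (gramCoeff a) (gramCoeff_comm a) (gramCoeff_neg_neg a) k l)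
      Bo B3o hBBo dod _ _ hd hfar hU1 (fun N x ↦ by
        have h := hU2 N x
        simp only [hMod, hdod] at h ⊢
        exact h) (fun x ↦ by
        have h := hSo x
        simp only [hMod, Matrix.of_apply] at h ⊢
        exact h) K z
    simpa only [hMod] using key

end Rung

end Summit.RiemannHypothesis.RiemannHypothesis.Theorems.WeilFormatC

end
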